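import Summits.ResolutionOfSingularities.ResolutionOfSingularities.Theorems.PurelyInseparableDim4InScopeWinCertFast
import HarnessLib
import HarnessLib.Audit.Tags

/-!
# Purely inseparable fourfolds — FULL-GAME WIN CERTIFICATES, FAST CHECKER (Hasse–Taylor equimultiplicity test)
# [OURS · counted 0 · a certificate format for OUR frame v4, not about resolution]

Census cell «res-dim4-pi» (D-0157 DOOR 2), width seat `res-dim4-p-14` (generation 3).  Sequel of
`PurelyInseparableDim4WinCertSound` (`WCert`, `winCertB`, `stateWins_of_winCertB`: the FULL coordinate game, every
`K`-rational reply of player B) and of `PurelyInseparableDim4InScopeWinCertFast` (the Hasse–Taylor test `equiHB`).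

WHAT.  `winCertHB q` is `winCertB q` with the equimultiplicity test `StepKit.equiB` (translate-and-expand, the kernel cost driver)
replaced by `InScopeWinCert.equiHB` (every Hasse derivative `D^{(α)}G`, `0 < |α| < q`, of the chart transform vanishes at the
reply point — `|idxLT q|·m` monomial evaluations).  Soundness is REDUCED row by row to the landed checker (`rowOK_of_rowHOK`,
`winCertB_of_winCertHB`), so the certified statement is literally the old one: `StateWins q row.1.toState` for every row.

Riders as before: `K`-rational replies over the finite field `K` of the certificate only (NOT ∀K); a statement about OUR frame-v4
game; nothing here proves resolution of singularities in dimension ≥ 4 / characteristic `p`; F4-C(2,2) neither proved nor refuted.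
[OURS · counted 0 · AI kernel work, weaker than expert review.]
bears_on: LADDER-RESOLUTION:D157-DOOR2 (res-dim4-pi · F4-C instrument · certificate format). Supports
stmt-ResolutionOfSingularities-16155 (helper).
-/

set_option linter.dupNamespace false

noncomputable section

namespace Summit.ResolutionOfSingularities.ResolutionOfSingularities.Theorems.PIDim4

namespace WinCertSound

open StepKit InScopeWinCert
open Literature.AlgebraicGeometry.Resolution
open Literature.AlgebraicGeometry.Resolution.CentreBlowup

variable {K : Type} [Field K] [DecidableEq K]

/-- B's reply `(j, b)` is harmless (fast form): rejected by the Hasse–Taylor test, or kills `F`, or certified later. [folklore] -/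
def replyHOK (q : ℕ) (rest : WCert K) (s : SData 4 K) (S : Finset (Fin 4)) (j : Fin 4) (b : Fin 4 → K) : Bool :=
  !(equiHB q S j b s) || StepKit.equivB (stepD q S j b s).L [] || childIn rest (stepD q S j b s)

/-- A fast-harmless reply is harmless. [folklore] -/
theorem replyOK_of_replyHOK {q : ℕ} {rest : WCert K} {s : SData 4 K} {S : Finset (Fin 4)} {j : Fin 4} {b : Fin 4 → K}
    (h : replyHOK q rest s S j b = true) : replyOK q rest s S j b = true := by
  unfold replyHOK at h
  unfold replyOK
  cases hH : equiHB q S j b s with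
  | false => rw [equiB_eq_false_of_equiHB hH]; simp
  | true =>
    rw [hH] at h
    simp only [Bool.not_true, Bool.false_or, Bool.or_eq_true] at h
    rcases h with h | h <;> simp [h]

variable [Fintype K]

/-- The row check (fast form): TERMINAL (origin not `q`-fold), or a permissible centre all of whose `K`-rational replies are
harmless. [folklore] -/
def rowHOK (q : ℕ) (rest : WCert K) (row : WRow K) : Bool :=
  !(permB q Finset.univ row.1.L) ||
    (permB q row.2 row.1.L &&
      decide (∀ j ∈ row.2, ∀ b : Fin 4 → K, b j = 0 → replyHOK q rest row.1 row.2 j b = true))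

/-- **The fast full-game win-certificate checker** (children LATER in the list). [folklore] -/
def winCertHB (q : ℕ) : WCert K → Bool
  | [] => true
  | row :: rest => rowHOK q rest row && winCertHB q rest

/-- A fast-OK row is OK. [folklore] -/
theorem rowOK_of_rowHOK {q : ℕ} {rest : WCert K} {row : WRow K} (h : rowHOK q rest row = true) :
    rowOK q rest row = true := by
  unfold rowHOK at h
  unfold rowOK
  simp only [Bool.or_eq_true, Bool.and_eq_true, Bool.not_eq_true', decide_eq_true_eq] at h ⊢
  rcases h with ht | ⟨hp, hr⟩
  · exact Or.inl ht
  · exact Or.inr ⟨hp, fun j hj b hb => replyOK_of_replyHOK (hr j hj b hb)⟩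

/-- **Reduction**: a certificate passing the fast checker passes the landed checker. [folklore] -/
theorem winCertB_of_winCertHB {q : ℕ} : ∀ {T : WCert K}, winCertHB q T = true → winCertB q T = true
  | [], _ => rfl
  | row :: rest, h => by
    simp only [winCertHB, Bool.and_eq_true] at h
    simp only [winCertB, Bool.and_eq_true]
    exact ⟨rowOK_of_rowHOK h.1, winCertB_of_winCertHB h.2⟩

/-- **SOUNDNESS OF THE FAST FULL-GAME CHECKER**: every row state of a certificate passing `winCertHB` is ESCAPABLE (`StateWins`:
player A beats every `K`-rational sequence of replies). [folklore] -/
theorem stateWins_of_winCertHB {q : ℕ} {T : WCert K} (h : winCertHB q T = true) : ∀ row ∈ T, StateWins q row.1.toState :=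
  stateWins_of_winCertB (winCertB_of_winCertHB h)

/-- Batch form: every certificate of a list passing the fast checker has all its row states escapable. [folklore] -/
theorem stateWins_of_all_winCertHB {q : ℕ} {Ts : List (WCert K)} (h : Ts.all (winCertHB q) = true) :
    ∀ T ∈ Ts, ∀ row ∈ T, StateWins q row.1.toState :=
  fun T hT => stateWins_of_winCertHB (List.all_eq_true.mp h T hT)

/-! ## Model -/

/-- The PR-12 model certificate `exampleCert` (`x₁³` over `𝔽₂`) passes the fast checker. [OURS · ‖ K] [folklore] -/
theorem winCertHB_example : winCertHB 2 exampleCert = true := by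
  decide +kernel

end WinCertSound

end Summit.ResolutionOfSingularities.ResolutionOfSingularities.Theorems.PIDim4

end
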